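import Literature.AnabelianGeometry.EtaleTheta.ThetaCoversLampModelElements
import Literature.AnabelianGeometry.EtaleTheta.ThetaCoversLampModelCoverData

/-!
# The lamplighter model ([EtTh] §2 interface), part 3 (PROOF-ONLY): `Π_C = A × Q̂` IS the profinite completion of
# `Π^tp_C = A × Q₀` — density and the pull-back of open normal finite-index subgroups (abc-iut-L3's `IsProfiniteCompletion`)

S. Mochizuki, *The étale theta function …*, Publ. RIMS **45** (2009) [MochizukiEtTh2009], §2 Def. 2.5 p. 39 («`Π^tp_C`, … its
profinite completion `Π_C`», [SemiAnbd] Prop. 3.6) and Lemma 2.17 (ii) p. 58 [cite: MochizukiEtTh2009, Def 2.5 p.39].  abc-iut cell,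
block F, seat abc-iut-f-142 (row F-0606, INSTANCE form).  PROOF-ONLY companion (0 definitions) of
`ThetaCoversLampModelDefs/Elements/CoverData.lean`.
* §0 basic neighbourhoods: membership in a neighbourhood of `∏ W_n`, `Q̂`, `Q₀` is decided at finitely many levels (and, in
  `Q₀`, by the degree); an open subgroup of `Π^tp_C` contains all `(1, x)`, `x` of degree `0` trivial below some level.
* §1 `denseRange_toHat` — truncate and continue by the integer lifting the last rotation part.
* §2 `comap_surjective_toHat` — an open normal `U ⊆ Π^tp_C` of index `d` contains `ζ^d` and a basic neighbourhood of level
  `N₀`; an element of `Q₀` trivial below level `N₀ + d + 1` has degree divisible by `N_{N₀+d} ∋ d`, so `toHat⁻¹(1 × lev) ⊆ U`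
  and `U = toHat⁻¹(toHat(U) · (1 × lev))`, the latter being normal because it is closed and normalised by the dense image.
* `isProfiniteCompletion_toHat` — the L3 predicate, all clauses.

HONEST FRAMING. A DESIGNED consistency witness for OUR typed interface (`G_K = 1`; lamplighter groups, not
fundamental groups of curves): it decides which typed sentences are CONSEQUENCES of the interface and which are not;
nothing of [EtTh] is asserted or denied for genuine tempered fundamental groups; instance-at-a-designed-carrier ≠ the
printed lemma; no side is taken on [IUTchIII] Cor. 3.12 or on any author; nothing here bears on abc. typed ≠ proved.
-/

noncomputable section

namespace Literature.AnabelianGeometry.EtaleTheta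

namespace ThetaCovers

namespace LampModel

section Part_3a

open Multiplicative HeisenbergWitness Topology Filter Literature.AnabelianGeometry.SemiGraphs

variable (l : ℕ)

/-! ## 0. Basic neighbourhoods: membership is decided at finitely many levels -/

section Nhds

open Topology Filter

/-- A neighbourhood of `y` in `∏ₙ W_n` contains all sequences agreeing with `y` below some level. (elementary; toy bookkeeping) [cite: MochizukiEtTh2009, Lem 2.17(ii) p.58] -/
theorem exists_level_of_mem_nhds_Qfull {U : Set Qfull} {y : Qfull} (hU : U ∈ 𝓝 y) :
    ∃ N, ∀ y' : Qfull, (∀ n, n < N → y' n = y n) → y' ∈ U := by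
  rw [nhds_pi, Filter.mem_pi] at hU
  obtain ⟨I, hI, t, ht, hts⟩ := hU
  obtain ⟨N, hN⟩ := hI.bddAbove
  refine ⟨N + 1, fun y' hy' => hts fun i hi => ?_⟩
  rw [hy' i (Nat.lt_succ_of_le (hN hi))]
  exact mem_of_mem_nhds (ht i)

/-- The same in `Q̂`. (toy bookkeeping) [cite: MochizukiEtTh2009, Lem 2.17(ii) p.58] -/
theorem exists_level_of_mem_nhds_Qc {U : Set Qc} {y : Qc} (hU : U ∈ 𝓝 y) :
    ∃ N, ∀ y' : Qc, (∀ n, n < N → (y' : Qfull) n = (y : Qfull) n) → y' ∈ U := by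
  obtain ⟨V, hV, hVU⟩ := (mem_nhds_subtype _ y U).mp hU
  obtain ⟨N, hN⟩ := exists_level_of_mem_nhds_Qfull hV
  exact ⟨N, fun y' hy' => hVU (hN _ hy')⟩

/-- The same in `Q₀`: a neighbourhood of `x` contains all elements of the same degree agreeing with `x` below
some level. (toy bookkeeping) [cite: MochizukiEtTh2009, Lem 2.17(ii) p.58] -/
theorem exists_level_of_mem_nhds_Qt {U : Set Qt} {x : Qt} (hU : U ∈ 𝓝 x) :
    ∃ N, ∀ x' : Qt, (∀ n, n < N → (((x' : Qc × Multiplicative ℤ).1 : Qfull) n) =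
      (((x : Qc × Multiplicative ℤ).1 : Qfull) n)) →
      (x' : Qc × Multiplicative ℤ).2 = (x : Qc × Multiplicative ℤ).2 → x' ∈ U := by
  obtain ⟨V, hV, hVU⟩ := (mem_nhds_subtype _ x U).mp hU
  obtain ⟨u, hu, v, hv, huv⟩ := mem_nhds_prod_iff.mp hV
  obtain ⟨N, hN⟩ := exists_level_of_mem_nhds_Qc hu
  refine ⟨N, fun x' h1 h2 => hVU (huv ⟨hN _ h1, ?_⟩)⟩
  rw [h2]
  exact mem_of_mem_nhds hv

end Nhds

/-- An OPEN subgroup of `Π^tp_C` contains every `(1, x)` with `x ∈ Q₀` of degree `0` and trivial below some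
level `N₀` (a basic neighbourhood of the identity). (toy bookkeeping) [cite: MochizukiEtTh2009, Lem 2.17(ii) p.58] -/
theorem exists_level_one_mem (H : Subgroup (Gtp l)) (hH : IsOpen (H : Set (Gtp l))) :
    ∃ N, ∀ x : Qt, (∀ n, n < N → (((x : Qc × Multiplicative ℤ).1 : Qfull) n) = 1) →
      (x : Qc × Multiplicative ℤ).2 = 1 → ((1 : A l), x) ∈ H := by
  have h1 : (H : Set (Gtp l)) ∈ nhds ((1 : A l), (1 : Qt)) := hH.mem_nhds H.one_mem
  obtain ⟨u, hu, v, hv, huv⟩ := mem_nhds_prod_iff.mp h1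
  obtain ⟨N, hN⟩ := exists_level_of_mem_nhds_Qt hv
  exact ⟨N, fun x hx hx2 => huv ⟨mem_of_mem_nhds hu, hN x hx hx2⟩⟩

/-! ## 1. Density of `Π^tp_C` in `Π_C` -/

/-- **`A × Q₀` is dense in `A × Q̂`**: truncate a coherent sequence at level `N` and continue it by the integer
lifting its level-`N` rotation part, lamps off. (toy bookkeeping) [cite: MochizukiEtTh2009, Lem 2.17(ii) p.58] -/
theorem denseRange_toHatL : DenseRange (toHatL l) := by
  intro y
  rw [mem_closure_iff_nhds]
  intro t ht
  obtain ⟨u, hu, v, hv, huv⟩ := mem_nhds_prod_iff.mp ht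
  obtain ⟨N, hN⟩ := exists_level_of_mem_nhds_Qc hv
  let k : ℤ := ((toAdd ((y.2 : Qfull) N).right).val : ℕ)
  let m : ∀ n, F n := fun n => if n < N then ((y.2 : Qfull) n).left else 1
  have hm : EvCF m := evCF_of_eventually_one (N := N) fun n hn => by
    simp only [m, if_neg (not_lt.mpr hn)]
  refine ⟨toHatL l (y.1, mkQt m k hm), huv ⟨mem_of_mem_nhds hu, hN _ fun n hn => ?_⟩, ⟨_, rfl⟩⟩
  change (⟨m n, ofAdd (k : ZMod (Nl n))⟩ : W n) = (y.2 : Qfull) n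
  refine SemidirectProduct.ext (by simp only [m, if_pos hn]) ?_
  change ofAdd ((k : ZMod (Nl n))) = ((y.2 : Qfull) n).right
  rw [intCast_val_eq_right y.2 hn.le, ofAdd_toAdd]

/-! ## 2. Every open normal finite-index subgroup of `Π^tp_C` is pulled back from `Π_C` -/

/-- If `x ∈ Q₀` is trivial at level `N`, its degree is divisible by `N_N`. (toy bookkeeping)
[cite: MochizukiEtTh2009, Lem 2.17(ii) p.58] -/
theorem Nl_dvd_deg_of_levels {x : Qt} {N : ℕ} (hx : (((x : Qc × Multiplicative ℤ).1 : Qfull) N) = 1) :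
    (Nl N : ℤ) ∣ toAdd (x : Qc × Multiplicative ℤ).2 := by
  have h := x.2.1 N
  rw [hx, SemidirectProduct.one_right, toAdd_one] at h
  exact (ZMod.intCast_zmod_eq_zero_iff_dvd _ _).mp h.symm

/-- A closed subgroup of `Π_C` normalised by the (dense) image of `Π^tp_C` is normal. (toy bookkeeping)
[cite: MochizukiEtTh2009, Lem 2.17(ii) p.58] -/
theorem normal_of_isClosed_of_conj {M : Subgroup (P l)} (hM : IsClosed (M : Set (P l)))
    (hconj : ∀ g : Gtp l, ∀ m ∈ M, toHatL l g * m * (toHatL l g)⁻¹ ∈ M) : M.Normal := by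
  let T : Set (P l) := {p | ∀ m ∈ M, p * m * p⁻¹ ∈ M}
  have hT : IsClosed T := by
    have : T = ⋂ m ∈ (M : Set (P l)), (fun p : P l => p * m * p⁻¹) ⁻¹' (M : Set (P l)) := by
      ext p; simp [T]
    rw [this]
    exact isClosed_biInter fun m _ => hM.preimage (by fun_prop)
  have hrange : Set.range (toHatL l) ⊆ T := by
    rintro _ ⟨g, rfl⟩ m hm
    exact hconj g m hm
  have hall : ∀ p, p ∈ T := fun p => by
    have := (hT.closure_subset_iff.mpr hrange) ((denseRange_toHatL l).closure_range ▸ Set.mem_univ p)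
    exact this
  exact ⟨fun m hm p => hall p m hm⟩

/-- **The pull-back clause**: every open normal subgroup `U` of finite index `d` of `Π^tp_C` is the inverse image
of an open normal subgroup of `Π_C`, namely `toHatL(U) · (1 × lev(N₀ + d + 1))` — using `ζ^d ∈ U` and that an
element of `Q₀` trivial below level `N₀ + d + 1` has degree divisible by `d`. (toy bookkeeping)
[cite: MochizukiEtTh2009, Lem 2.17(ii) p.58] -/
theorem comap_surjective_toHatL (U : OpenNormalSubgroup (Gtp l)) (hU : U.toSubgroup.FiniteIndex) :
    ∃ V : OpenNormalSubgroup (P l), U.toSubgroup = V.toSubgroup.comap (toHatL l) := by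
  obtain ⟨N₀, hN₀⟩ := exists_level_one_mem l U.toSubgroup U.isOpen'
  set d : ℕ := U.toSubgroup.index with hd_def
  have hd : 0 < d := Nat.pos_of_ne_zero hU.index_ne_zero
  -- `(1, ζ^d) ∈ U`
  have hζd : ((1 : A l), zetaHom (ofAdd (d : ℤ))) ∈ U.toSubgroup := by
    have h := U.toSubgroup.pow_index_mem ((1 : A l), zetaHom (ofAdd (1 : ℤ)))
    rwa [Prod.pow_mk, one_pow, ← map_pow, ← ofAdd_nsmul, ← hd_def, Nat.smul_one_eq_cast] at h
  let N₁ : ℕ := N₀ + d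
  -- the open normal subgroup `V := 1 × lev (N₁ + 1)` of `Π_C`
  haveI : (lev (N₁ + 1)).Normal := lev_normal _
  let V : OpenNormalSubgroup (P l) :=
    { toSubgroup := (⊥ : Subgroup (A l)).prod (lev (N₁ + 1))
      isOpen' := (isOpen_discrete _).prod (isOpen_lev _) }
  -- Claim A: `toHatL⁻¹(V) ⊆ U`
  have hA : ∀ g : Gtp l, toHatL l g ∈ V.toSubgroup → g ∈ U.toSubgroup := by
    rintro ⟨a, x⟩ hg
    obtain ⟨ha, hx⟩ := Subgroup.mem_prod.mp hg
    rw [Subgroup.mem_bot] at ha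
    subst ha
    change ιQ x ∈ lev (N₁ + 1) at hx
    set k : ℤ := toAdd (x : Qc × Multiplicative ℤ).2 with hk_def
    have hdvd : (Nl N₁ : ℤ) ∣ k := Nl_dvd_deg_of_levels (hx N₁ (Nat.lt_succ_self _))
    have hdk : (d : ℤ) ∣ k :=
      (Int.natCast_dvd_natCast.mpr (dvd_Nl hd (by omega))).trans hdvd
    obtain ⟨e, he⟩ := hdk
    -- `(1, ζ^k) ∈ U`
    have hζk : ((1 : A l), zetaHom (ofAdd k)) ∈ U.toSubgroup := by
      have : ((1 : A l), zetaHom (ofAdd k)) = ((1 : A l), zetaHom (ofAdd (d : ℤ))) ^ e := by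
        rw [Prod.pow_mk, one_zpow, ← map_zpow, ← ofAdd_zsmul, smul_eq_mul, he, mul_comm]
      rw [this]
      exact Subgroup.zpow_mem _ hζd e
    -- `x · ζ^{-k}` has degree `0` and is trivial below `N₁ + 1`
    have hx' : ((1 : A l), x * zetaHom (ofAdd (-k))) ∈ U.toSubgroup := by
      refine hN₀ _ (fun n hn => ?_) ?_
      · have hxn : (((x : Qc × Multiplicative ℤ).1 : Qfull) n) = 1 := hx n (by omega)
        have hkn : ((-k : ℤ) : ZMod (Nl n)) = 0 := by
          rw [Int.cast_neg, neg_eq_zero, ZMod.intCast_zmod_eq_zero_iff_dvd]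
          exact (Int.natCast_dvd_natCast.mpr (Nl_dvd (by omega : n ≤ N₁))).trans hdvd
        change (((x : Qc × Multiplicative ℤ).1 : Qfull) n) *
          ((((zetaHom (ofAdd (-k)) : Qt) : Qc × Multiplicative ℤ).1 : Qfull) n) = 1
        rw [hxn, one_mul]
        refine SemidirectProduct.ext (zetaHom_apply_left _ _) ?_
        rw [zetaHom_apply_right, toAdd_ofAdd, hkn, ofAdd_zero, SemidirectProduct.one_right]
      · change (x : Qc × Multiplicative ℤ).2 * ((zetaHom (ofAdd (-k)) : Qt) : Qc × Multiplicative ℤ).2 = 1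
        rw [zetaHom_snd, hk_def, ofAdd_neg, ofAdd_toAdd, mul_inv_cancel]
    have : ((1 : A l), x) = ((1 : A l), x * zetaHom (ofAdd (-k))) * ((1 : A l), zetaHom (ofAdd k)) := by
      rw [Prod.mk_mul_mk, one_mul, mul_assoc, ← map_mul, ← ofAdd_add, neg_add_cancel, ofAdd_zero,
        map_one, mul_one]
    rw [this]
    exact U.toSubgroup.mul_mem hx' hζk
  -- the open normal subgroup `V' := toHatL(U) · V`
  let M : Subgroup (P l) := U.toSubgroup.map (toHatL l) ⊔ V.toSubgroup
  have hMopen : IsOpen (M : Set (P l)) := Subgroup.isOpen_mono le_sup_right V.isOpen'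
  haveI : V.toSubgroup.Normal := V.isNormal'
  have hMnormal : M.Normal := by
    refine normal_of_isClosed_of_conj l (M.isClosed_of_isOpen hMopen) fun g m hm => ?_
    obtain ⟨y, hy, z, hz, rfl⟩ := Subgroup.mem_sup_of_normal_right.mp hm
    obtain ⟨u, hu, rfl⟩ := Subgroup.mem_map.mp hy
    have e : toHatL l g * (toHatL l u * z) * (toHatL l g)⁻¹ =
        toHatL l (g * u * g⁻¹) * (toHatL l g * z * (toHatL l g)⁻¹) := by
      rw [map_mul, map_mul, map_inv]; group
    rw [e]
    exact Subgroup.mul_mem _ (Subgroup.mem_sup_left (Subgroup.mem_map_of_mem _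
      (U.isNormal'.conj_mem u hu g))) (Subgroup.mem_sup_right (V.isNormal'.conj_mem z hz _))
  refine ⟨{ toSubgroup := M, isOpen' := hMopen, isNormal' := hMnormal }, ?_⟩
  ext g
  constructor
  · intro hg
    exact Subgroup.mem_sup_left (Subgroup.mem_map_of_mem _ hg)
  · intro hg
    change toHatL l g ∈ M at hg
    obtain ⟨y, hy, z, hz, hyz⟩ := Subgroup.mem_sup_of_normal_right.mp hg
    obtain ⟨u, hu, rfl⟩ := Subgroup.mem_map.mp hy
    have hz' : z = toHatL l (u⁻¹ * g) := by
      rw [map_mul, map_inv, ← hyz, inv_mul_cancel_left]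
    have hug : u⁻¹ * g ∈ U.toSubgroup := hA _ (hz' ▸ hz)
    have : g = u * (u⁻¹ * g) := by group
    rw [this]
    exact U.toSubgroup.mul_mem hu hug

/-- **`Π_C = A × Q̂` is THE profinite completion of `Π^tp_C = A × Q₀`** in the sense of abc-iut-L3's frozen
predicate `SemiGraphs.IsProfiniteCompletion` (compact Hausdorff totally disconnected target, dense image, open
normal finite-index subgroups are pulled back). (toy bookkeeping) [cite: MochizukiEtTh2009, Def 2.5 p.39] -/
theorem isProfiniteCompletion_toHatL [NeZero l] :
    IsProfiniteCompletion (⟨toHatL l, continuous_toHatL l⟩ : Gtp l →ₜ* P l) where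
  compactSpace := inferInstance
  t2Space := inferInstance
  totallyDisconnectedSpace := inferInstance
  denseRange := denseRange_toHatL l
  comap_surjective := comap_surjective_toHatL l
  isOpen_comap V := V.isOpen'.preimage (continuous_toHatL l)

end Part_3a

end LampModel

end ThetaCovers

end Literature.AnabelianGeometry.EtaleTheta
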